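import Mathlib.Analysis.Calculus.ContDiff.Operations
import Mathlib.Analysis.SpecialFunctions.Sqrt
import Mathlib.Topology.Separation.Basic
import Literature.Geometry.Lorentzian.HorizonPenetratingTeukolsky
import HarnessLib

/-!
# Fields of a sourced Teukolsky slab pair are smooth off the axis and off `{Δ = 0}`

Stub `D0` (`stub_slabPair_contDiffAt`) of the line `bounded-kappa-closing-box` for the crux
`BulkKerrCaptureC2` (route `PhaseMixingCapture`): the analytic input of the dilation covariance of
the slab law `Kerr.TeukolskySlabLawOn`. In a sourced Teukolsky pair `(α, F)` on a time slab
`τ₀ ≤ t* ≤ τ₁` of the horizon-penetrating chart `Kerr.region a r₀` (`Kerr.IsTeukolskyPairOnSlab`)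
the field `α` itself carries no regularity hypothesis: only the rescaled tensorised field
`α̃ m_s ⊗ m_s = Kerr.tensorise a s (Kerr.rescale M a s α)` is asked to agree, off the axis and off
`{Δ = 0}`, with a tensor field `T` that is `C^∞` on the open neighbourhood
`U_θ = {τ₀ − θ < t* < τ₁ + θ}` of the slab. We prove that the extension by zero of `α` to `E4`
is `C^∞` at every point `x ∈ U_θ` off the axis with `Δ(r(x)) ≠ 0`.

Proof. The `(3, 3)` Cartesian component of `α̃ m_s ⊗ m_s` is `Φ · α` with the REAL factor
`Φ = Δ^s (r² + a²)^{−max(s,0)} (r sin θ)²` (`(m_s)₃ = −r sin θ` for either sign of `s`), and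
`Φ` is `C^∞` and non-vanishing on the open set `{r > 0} ∩ {ϖ ≠ 0} ∩ {Δ ≠ 0}`
(`Kerr.contDiffAt_radius_comp`; `sin θ = ϖ/√(r² + a²)`, `ϖ = √(x₁² + x₂²)`). Hence near `x` the
extension of `α` agrees with `Φ⁻¹ • Ψ₃₃`, `Ψ` the extension by zero of `T` (a `C^∞`
representative of `T` at `x`, `OpensChart.contMDiffAt_iff`), which is `C^∞` at `x`.
-/

-- the doubled `FinalStateConjecture.FinalStateConjecture` path component trips dupNamespace
set_option linter.dupNamespace false

noncomputable section

namespace Summit.FinalStateConjecture.FinalStateConjecture.Theorems.BulkKerrCaptureC2.SlabPairContDiff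

open Literature.Geometry.Lorentzian
open Set Filter
open scoped Manifold ContDiff Topology

/-! ### Smoothness and non-vanishing of the factor `Φ = Δ^s (r² + a²)^{−max(s,0)} (r sin θ)²` -/

/-- An integer power of a real `C^n` function is `C^n` at every point where the function does not
vanish (cases on the sign of the exponent: `pow`, resp. `inv ∘ pow`). -/
private theorem contDiffAt_zpow_of_ne {F : Type*} [NormedAddCommGroup F] [NormedSpace ℝ F]
    {f : F → ℝ} {p : F} {n : WithTop ℕ∞} (hf : ContDiffAt ℝ n f p) (h : f p ≠ 0) (m : ℤ) :
    ContDiffAt ℝ n (fun q ↦ f q ^ m) p := by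
  cases m with
  | ofNat k =>
    simp only [Int.ofNat_eq_natCast, zpow_natCast]
    exact hf.pow k
  | negSucc k =>
    simp only [zpow_negSucc]
    exact (hf.pow (k + 1)).inv (pow_ne_zero _ h)

/-- Off the axis `{x₁ = x₂ = 0}` one has `x₁² + x₂² > 0`. -/
private theorem coord_sq_add_sq_pos {y : E4} (hy : y ∉ Kerr.axis) : 0 < y 1 ^ 2 + y 2 ^ 2 := by
  rcases not_and_or.1 hy with h | h
  · exact add_pos_of_pos_of_nonneg (sq_pos_of_ne_zero h) (sq_nonneg _)
  · exact add_pos_of_nonneg_of_pos (sq_nonneg _) (sq_pos_of_ne_zero h)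

/-- `sin θ = ϖ / √(r² + a²)` does not vanish off the axis (where `ϖ > 0`) at points with `r > 0`. -/
private theorem sinTheta_ne_zero {a : ℝ} {y : E4} (hr : 0 < Kerr.radius a y) (hy : y ∉ Kerr.axis) :
    Kerr.sinTheta a y ≠ 0 := by
  have h12 : 0 < y 1 ^ 2 + y 2 ^ 2 := coord_sq_add_sq_pos hy
  unfold Kerr.sinTheta Kerr.axialRadius
  exact div_ne_zero (Real.sqrt_pos.2 h12).ne' (Real.sqrt_pos.2 (by positivity)).ne'

/-- The factor `Φ = Δ^s (r² + a²)^{−max(s,0)} (r sin θ)²` does not vanish at points with `r > 0`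
off the axis and off `{Δ = 0}`. -/
private theorem factor_ne_zero {M a : ℝ} (s : ℤ) {y : E4} (hr : 0 < Kerr.radius a y)
    (hy : y ∉ Kerr.axis) (hΔ : Kerr.delta M a (Kerr.radius a y) ≠ 0) :
    Kerr.delta M a (Kerr.radius a y) ^ s * (Kerr.radius a y ^ 2 + a ^ 2) ^ (-max s 0) *
        (Kerr.radius a y * Kerr.sinTheta a y) ^ 2 ≠ 0 := by
  have hra : Kerr.radius a y ^ 2 + a ^ 2 ≠ 0 := by positivity
  exact mul_ne_zero (mul_ne_zero (zpow_ne_zero _ hΔ) (zpow_ne_zero _ hra))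
    (pow_ne_zero _ (mul_ne_zero hr.ne' (sinTheta_ne_zero hr hy)))

/-- The factor `Φ = Δ^s (r² + a²)^{−max(s,0)} (r sin θ)²` is `C^∞` at points with `r > 0` off the
axis and off `{Δ = 0}`: `r` is smooth where positive (`Kerr.contDiffAt_radius_comp`), `Δ` is a
polynomial in `r`, `ϖ = √(x₁² + x₂²)` is smooth off the axis and `√(r² + a²)` where `r > 0`. -/
private theorem contDiffAt_factor {M a : ℝ} (s : ℤ) {y : E4} (hr0 : 0 < Kerr.radius a y)
    (hy : y ∉ Kerr.axis) (hΔ0 : Kerr.delta M a (Kerr.radius a y) ≠ 0) :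
    ContDiffAt ℝ ∞ (fun z : E4 ↦
      Kerr.delta M a (Kerr.radius a z) ^ s * (Kerr.radius a z ^ 2 + a ^ 2) ^ (-max s 0) *
        (Kerr.radius a z * Kerr.sinTheta a z) ^ 2) y := by
  have hr : ContDiffAt ℝ ∞ (fun z : E4 ↦ Kerr.radius a z) y :=
    Kerr.contDiffAt_radius_comp (fa := fun _ : E4 ↦ a) (g := id) contDiffAt_const contDiffAt_id
      hr0
  have hΔ : ContDiffAt ℝ ∞ (fun z : E4 ↦ Kerr.delta M a (Kerr.radius a z)) y := by
    unfold Kerr.delta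
    exact ((hr.pow 2).sub (contDiffAt_const.mul hr)).add contDiffAt_const
  have hra : ContDiffAt ℝ ∞ (fun z : E4 ↦ Kerr.radius a z ^ 2 + a ^ 2) y :=
    (hr.pow 2).add contDiffAt_const
  have hra0 : Kerr.radius a y ^ 2 + a ^ 2 ≠ 0 := by positivity
  have h12 : ContDiffAt ℝ ∞ (fun z : E4 ↦ z 1 ^ 2 + z 2 ^ 2) y :=
    (((Kerr.contDiff_coord 1).pow 2).add ((Kerr.contDiff_coord 2).pow 2)).contDiffAt
  have hax : ContDiffAt ℝ ∞ (fun z : E4 ↦ Kerr.axialRadius z) y := by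
    unfold Kerr.axialRadius
    exact h12.sqrt (coord_sq_add_sq_pos hy).ne'
  have hsin : ContDiffAt ℝ ∞ (fun z : E4 ↦ Kerr.sinTheta a z) y := by
    unfold Kerr.sinTheta
    exact hax.div (hra.sqrt hra0) (Real.sqrt_pos.2 (by positivity)).ne'
  exact ((contDiffAt_zpow_of_ne hΔ hΔ0 s).mul (contDiffAt_zpow_of_ne hra hra0 _)).mul
    ((hr.mul hsin).pow 2)

/-! ### The `(3, 3)` component of `α̃ m_s ⊗ m_s` -/

/-- The third Cartesian component of the spin frame `m_s` is the real number `−r sin θ`, for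
either sign of `s` (`m̄₃ = m₃`). -/
private theorem spinFrame_three (a : ℝ) (s : ℤ) (x : E4) :
    Kerr.spinFrame a s x 3 = ((-(Kerr.radius a x * Kerr.sinTheta a x) : ℝ) : ℂ) := by
  have h3 : Kerr.frameM a x 3 = ((-(Kerr.radius a x * Kerr.sinTheta a x) : ℝ) : ℂ) := rfl
  unfold Kerr.spinFrame
  split_ifs
  · rw [Pi.star_apply, h3]
    exact Complex.conj_ofReal _
  · exact h3

/-- `(α̃ m_s ⊗ m_s)₃₃ = Φ · α` with `Φ = Δ^s (r² + a²)^{−max(s,0)} (r sin θ)²`. -/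
private theorem tensorise_rescale_three_three (M a : ℝ) (s : ℤ) {U : TopologicalSpace.Opens E4}
    (α : U → ℂ) (z : E4) (hz : z ∈ U) :
    Kerr.tensorise a s (Kerr.rescale M a s α) ⟨z, hz⟩ 3 3 =
      ((Kerr.delta M a (Kerr.radius a z) ^ s * (Kerr.radius a z ^ 2 + a ^ 2) ^ (-max s 0) *
          (Kerr.radius a z * Kerr.sinTheta a z) ^ 2 : ℝ) : ℂ) * α ⟨z, hz⟩ := by
  simp only [Kerr.tensorise, Kerr.rescale, spinFrame_three, Complex.real_smul]
  push_cast
  ring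

/-! ### The stub -/

/-- **`D0` — fields of a sourced Teukolsky slab pair are `C^∞` off the axis and off `{Δ = 0}`**
(stub `stub_slabPair_contDiffAt` of the line `bounded-kappa-closing-box` for the crux
`BulkKerrCaptureC2`). If `(α, F)` is a sourced spin-`s` Teukolsky pair on the slab
`τ₀ ≤ t* ≤ τ₁` of the chart `{r > r₀}` (`Kerr.IsTeukolskyPairOnSlab`), then for the `θ > 0` of
the pair and every point `x` of the chart with `τ₀ − θ < t*(x) < τ₁ + θ`, `x` off the axis and
`Δ(r(x)) ≠ 0`, the extension by zero of `α` to `E4` is `C^∞` at `x`. Indeed the smooth witness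
`T` of the pair agrees near `x` with `α̃ m_s ⊗ m_s`, whose `(3, 3)` component is `Φ · α` with
`Φ = Δ^s (r² + a²)^{−max(s,0)} (r sin θ)²` smooth and non-vanishing near `x`
(`contDiffAt_factor`, `factor_ne_zero`), so `α = Φ⁻¹ • T₃₃` near `x`. -/
theorem stub_slabPair_contDiffAt :
    ∀ [Kerr.Facts] (M a r₀ : ℝ) [(Kerr.metric M a r₀).HasLeviCivita] (s : ℤ) (τ₀ τ₁ : ℝ)
      (α F : Kerr.region a r₀ → ℂ), Kerr.IsTeukolskyPairOnSlab M a r₀ s τ₀ τ₁ α F →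
      ∃ θ : ℝ, 0 < θ ∧ ∀ x : Kerr.region a r₀, τ₀ - θ < (x : E4) 0 → (x : E4) 0 < τ₁ + θ →
        (x : E4) ∉ Kerr.axis → Kerr.delta M a (Kerr.radius a (x : E4)) ≠ 0 →
        ContDiffAt ℝ ((⊤ : ℕ∞) : WithTop ℕ∞) (Function.extend Subtype.val α (0 : E4 → ℂ))
          (x : E4) := by
  intro _ M a r₀ _ s τ₀ τ₁ α F hpair
  obtain ⟨θ, hθ, ⟨T, hT, hTeq⟩, -, -⟩ := hpair
  refine ⟨θ, hθ, fun x h₀ h₁ hax hΔ ↦ ?_⟩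
  -- Step 1: the extension by zero of `T` is a representative of `T`, smooth at `x`.
  have hrep : ∀ y : Kerr.region a r₀, T y = Function.extend Subtype.val T 0 y := fun y ↦
    (Subtype.val_injective.extend_apply _ _ y).symm
  have hc0 : Continuous fun y : Kerr.region a r₀ ↦ (y : E4) 0 :=
    (Kerr.contDiff_coord (n := 0) 0).continuous.comp continuous_subtype_val
  have hopen : IsOpen {y : Kerr.region a r₀ | τ₀ - θ < (y : E4) 0 ∧ (y : E4) 0 < τ₁ + θ} :=
    (isOpen_lt continuous_const hc0).inter (isOpen_lt hc0 continuous_const)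
  have hTx : ContMDiffAt 𝓘(ℝ, E4) 𝓘(ℝ, Fin 4 → Fin 4 → ℂ) ∞ T x :=
    hT.contMDiffAt (hopen.mem_nhds ⟨h₀, h₁⟩)
  have hΨ : ContDiffAt ℝ ∞ (Function.extend Subtype.val T 0) (x : E4) :=
    (OpensChart.contMDiffAt_iff x T _ hrep).1 hTx
  have hΨ33 : ContDiffAt ℝ ∞ (fun z ↦ Function.extend Subtype.val T 0 z 3 3) (x : E4) :=
    contDiffAt_pi.1 (contDiffAt_pi.1 hΨ 3) 3
  -- Step 2: the factor `Φ` is smooth and non-vanishing at `x`.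
  have hr0 : 0 < Kerr.radius a (x : E4) := Kerr.radius_pos_of_mem_region x.2
  have hΦ := contDiffAt_factor (M := M) s hr0 hax hΔ
  have hΦ0 := factor_ne_zero (M := M) s hr0 hax hΔ
  -- Step 3: near `x`, the extension of `α` is `Φ⁻¹ • Ψ₃₃`.
  refine ((hΦ.inv hΦ0).smul hΨ33).congr_of_eventuallyEq ?_
  have hreg : ∀ᶠ z in 𝓝 (x : E4), z ∈ Kerr.region a r₀ := (Kerr.region a r₀).isOpen.mem_nhds x.2
  have hslab : ∀ᶠ z in 𝓝 (x : E4), τ₀ - θ < z 0 ∧ z 0 < τ₁ + θ :=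
    (Kerr.contDiff_coord (n := 0) 0).continuous.continuousAt.preimage_mem_nhds
      (Ioo_mem_nhds h₀ h₁)
  have haxis : ∀ᶠ z in 𝓝 (x : E4), z ∉ Kerr.axis := by
    have hcl : IsClosed Kerr.axis :=
      (isClosed_eq (Kerr.contDiff_coord (n := 0) 1).continuous continuous_const).inter
        (isClosed_eq (Kerr.contDiff_coord (n := 0) 2).continuous continuous_const)
    exact hcl.isOpen_compl.mem_nhds hax
  have hΔev : ∀ᶠ z in 𝓝 (x : E4), Kerr.delta M a (Kerr.radius a z) ≠ 0 := by
    have hc : Continuous fun z : E4 ↦ Kerr.delta M a (Kerr.radius a z) := by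
      unfold Kerr.delta
      exact (((Kerr.continuous_radius a).pow 2).sub
        (continuous_const.mul (Kerr.continuous_radius a))).add continuous_const
    exact hc.continuousAt.eventually_ne hΔ
  filter_upwards [hreg, hslab, haxis, hΔev] with z hz hzs hzax hzΔ
  have hzr : 0 < Kerr.radius a z := Kerr.radius_pos_of_mem_region hz
  have hαz : Function.extend Subtype.val α (0 : E4 → ℂ) z = α ⟨z, hz⟩ :=
    Subtype.val_injective.extend_apply _ _ ⟨z, hz⟩
  have hTz : Function.extend Subtype.val T 0 z = T ⟨z, hz⟩ :=
    Subtype.val_injective.extend_apply _ _ ⟨z, hz⟩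
  have hne := Complex.ofReal_ne_zero.2 (factor_ne_zero (M := M) s hzr hzax hzΔ)
  simp only [Pi.inv_apply, Pi.smul_apply']
  rw [hαz, hTz, hTeq ⟨z, hz⟩ hzs.1 hzs.2 hzax hzΔ, tensorise_rescale_three_three,
    Complex.real_smul, Complex.ofReal_inv, ← mul_assoc, inv_mul_cancel₀ hne, one_mul]

end Summit.FinalStateConjecture.FinalStateConjecture.Theorems.BulkKerrCaptureC2.SlabPairContDiff

end
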